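import Summits.BirchSwinnertonDyer.BirchSwinnertonDyer.Theorems.SignedLowerHalvesKobayashiLowerHalfSemistableSplitBit

/-!
# Route `SignedLowerHalves`, crux `KobayashiLowerHalfSemistable` (item stmt-BirchSwinnertonDyer-19000): the SPLIT
# BIT, part B — link to the index bit of p456967 (split ⟺ scalar mod `X` ⟺ `[h]` generates `F_ε` ⟺ `ε = (0,0)`),
# invisibility of the bit when `X` is a unit, and pairwise non-isomorphism of the four lattices `L_ε`
# (cell `bsd-ssimc`, seat `bsd-ssimc-k3-c2` gen 11, object «SPLIT-BIT», planner ruling D22-4;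
# a `--supports stmt-BirchSwinnertonDyer-19000 --as helper` file: closes nothing)

PARTITION (cell bsd-ssimc): X6 ∧ r = 0 (A6) × the 12 cells at `p = 3` + X6 r1 @ 3 + D2 literal @ 3 —
types-the-object-of (the commutative algebra inside the WORDING OF RECORD of the `p = 3` residual (3-ii)♭′ of
Burungale–Skinner–Tian–Wan, arXiv:2409.01350, Part I Thm. 1.3, TARGET l.2 (b)); closes NONE; nothing booked.
HONEST FRAMING: pure commutative algebra (Mathlib notions only, sorry-free) in bstw-MEMO-10 §3–§4's RANK-3 LATTICE
MODEL, NOT the Λ-adic Hecke modules themselves: NOT (3-ii)♭′, NOT B1, NOT (m1)–(m4), NOT a binder, NO tier change;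
crux 2 kernel state p441716 (`KobayashiLowerHalfSemistable_of_tiersS_S3`) unchanged; nothing about modular curves,
Hida families or elliptic curves is asserted; BSD is not proved by any of this.

Source: `run/shared/lean/pub/bsd-ssimc/bstw-MEMO-10.md` (sha16 56db55b328bab2c5) §4 (C4) and §6 (R2)(i)/(R6);
k3c2-MEMO-9 (0065939d48bf7e9e) census V6. SYMBOL DICTIONARY: the ONE dictionary of p456967
(`…IndexTransfer.lean`) as extended in part A (`…SplitBit.lean`, same namespace): `R`, `X`, `L_ε = R × R × R` on
`(h, ẽ₁, ẽ₂)`, `ε₁ ε₂ ∈ {0,1}`, `φ_ε` ↔ `φ`/`hφ`, Hecke element `t` ↔ `(a, d₁, d₂)` with eigenvalues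
`(a, a + X d₁, a + X d₂)`, operator families `T`/`hT` (and a second family `T'`/`hT'` for a second `ε'`),
`Tb`/`hTb` on the cusp module `C = R × R`; NEW here: the relation module `𝔞L_ε = Σ_{λ₀(t)=0} t·L_ε` ↔
`⨆ d : R × R, range (T 0 d.1 d.2)`.

WHAT IS KERNEL-CHECKED (part B). (iv) **LINK**: `φ_ε ∘ T_t = λ₀(t)·φ_ε` (`phi_apply`: `φ_ε` is a
`λ_{𝐡_v}`-eigenfunctional), `𝔞L_ε ≤ ker φ_ε` and `(ε₁,X,0), (ε₂,0,X) ∈ 𝔞L_ε`, so p456967's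
`IndexTransfer.span_h_eq_top_iff` applies to `N = 𝔞L_ε` with `b = 1` (`span_h_eq_top_iff`); hence
`splitBit_tfae`: over a domain, `X ≠ 0` a non-unit, `ε_i ∈ {0,1}`: **ε = (0,0) ⟺ (♭′-1 fails) the extension
`0 → Rh → L_ε → C → 0` splits `T`-equivariantly ⟺ (♭′-3 fails) every `T_t` is scalar on `L_ε/XL_ε` ⟺ (index bit
fails) `[h]` generates the torsion-free quotient `F_ε` of `L_ε/𝔞L_ε`** — the three phrasings of TARGET l.2 (b)
agree in the model. (v) **INVISIBILITY away from `X = 0`** (`exists_equiv_of_isUnit`): if `X` is a unit then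
`L_ε ≃ L_ε'` `T`-equivariantly for ANY `ε, ε'` (explicit shear `(x₀,x₁,x₂) ↦ (x₀ − c₁x₁ − c₂x₂, x₁, x₂)`,
`c_i = X⁻¹(ε_i − ε'_i)`) — memo (R2)(i)/(R6): no classical specialisation `P ≠ (X)`, hence no numerics, sees the
bit. (vi) **V6**: over a domain with `X ≠ 0` a non-unit, `ε_i, ε'_i ∈ {0,1}`, a `T`-equivariant `R`-linear
isomorphism `L_ε ≃ L_ε'` forces `ε = ε'` (`eps_eq_of_equiv`; an intertwiner is triangular, `intertwiner_shape`)
— the four `L_ε` are pairwise non-isomorphic Hecke modules (memo §4); not used downstream, recorded to complete the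
dictionary.
References: BSTW arXiv:2409.01350v2 I Props. 3.9/3.11/3.13; bstw-MEMO-10 §4/§6; Kings–Loeffler–Zerbes, Camb. J.
Math. 5 (2017) Prop. 10.1.1. Design: THEOREMS ONLY (no def/structure/instance/notation/named fact).
-/

open Pointwise

-- lint debt, justified: the Theorems namespace repeats the summit name (D-0017); `dupNamespace` flags every decl.
set_option linter.dupNamespace false

namespace Summit.BirchSwinnertonDyer.BirchSwinnertonDyer.Theorems.SplitBit

variable {R : Type*} [CommRing R]

/-! ## (iv) LINK to the index bit of p456967 (`IndexTransfer.span_h_eq_top_iff`) -/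

section Link

variable {X ε₁ ε₂ : R} (T : R → R → R → ((R × R × R) →ₗ[R] (R × R × R)))
  (φ : (R × R × R) →ₗ[R] R)

/-- **`φ_ε` is a `λ₀`-eigenfunctional**: `φ_ε (T_t x) = λ₀(t) · φ_ε x` — the coordinate `φ_ε` of gen 10's
file is `𝓡`-equivariant for the character `λ_{𝐡_v}`, i.e. it factors through `L_ε ⊗_{𝓡,λ₀} R`. -/
theorem phi_apply
    (hT : ∀ (a d₁ d₂ : R) (x : R × R × R), T a d₁ d₂ x = (a * x.1 + ε₁ * d₁ * x.2.1 + ε₂ * d₂ * x.2.2,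
      (a + X * d₁) * x.2.1, (a + X * d₂) * x.2.2))
    (hφ : ∀ x : R × R × R, φ x = X * x.1 - ε₁ * x.2.1 - ε₂ * x.2.2) (a d₁ d₂ : R) (x : R × R × R) :
    φ (T a d₁ d₂ x) = a * φ x := by
  simp only [hT, hφ]
  ring

/-- Elements of `𝔞 = ker λ₀` kill `φ_ε`: `φ_ε (T_{(0,d₁,d₂)} x) = 0`. -/
theorem phi_apply_zero
    (hT : ∀ (a d₁ d₂ : R) (x : R × R × R), T a d₁ d₂ x = (a * x.1 + ε₁ * d₁ * x.2.1 + ε₂ * d₂ * x.2.2,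
      (a + X * d₁) * x.2.1, (a + X * d₂) * x.2.2))
    (hφ : ∀ x : R × R × R, φ x = X * x.1 - ε₁ * x.2.1 - ε₂ * x.2.2) (d₁ d₂ : R) (x : R × R × R) :
    φ (T 0 d₁ d₂ x) = 0 := by
  rw [phi_apply T φ hT hφ, zero_mul]

/-- **The relation module `𝔞L_ε = Σ_{λ₀(t)=0} T_t(L_ε)` lies in `ker φ_ε`** (hypothesis `hN` of p456967). -/
theorem phi_eq_zero_of_mem_iSup
    (hT : ∀ (a d₁ d₂ : R) (x : R × R × R), T a d₁ d₂ x = (a * x.1 + ε₁ * d₁ * x.2.1 + ε₂ * d₂ * x.2.2,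
      (a + X * d₁) * x.2.1, (a + X * d₂) * x.2.2))
    (hφ : ∀ x : R × R × R, φ x = X * x.1 - ε₁ * x.2.1 - ε₂ * x.2.2) :
    ∀ x ∈ ⨆ d : R × R, LinearMap.range (T 0 d.1 d.2), φ x = 0 := by
  intro x hx
  have hle : (⨆ d : R × R, LinearMap.range (T 0 d.1 d.2)) ≤ LinearMap.ker φ := by
    refine iSup_le fun d => ?_
    intro z hz
    obtain ⟨y, rfl⟩ := LinearMap.mem_range.1 hz
    exact LinearMap.mem_ker.2 (phi_apply_zero T φ hT hφ d.1 d.2 y)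
  exact hle hx

/-- `T_{(0,1,0)} ẽ₁ = X ẽ₁ + ε₁ h = (ε₁, X, 0)`: the first generator of `𝔞L_ε` in p456967's normalisation. -/
theorem apply_zero_one_zero_e₁
    (hT : ∀ (a d₁ d₂ : R) (x : R × R × R), T a d₁ d₂ x = (a * x.1 + ε₁ * d₁ * x.2.1 + ε₂ * d₂ * x.2.2,
      (a + X * d₁) * x.2.1, (a + X * d₂) * x.2.2)) :
    T 0 1 0 (0, 1, 0) = (ε₁, X, 0) := by
  rw [hT]
  simp

/-- `T_{(0,0,1)} ẽ₂ = X ẽ₂ + ε₂ h = (ε₂, 0, X)`: the second generator of `𝔞L_ε`. -/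
theorem apply_zero_zero_one_e₂
    (hT : ∀ (a d₁ d₂ : R) (x : R × R × R), T a d₁ d₂ x = (a * x.1 + ε₁ * d₁ * x.2.1 + ε₂ * d₂ * x.2.2,
      (a + X * d₁) * x.2.1, (a + X * d₂) * x.2.2)) :
    T 0 0 1 (0, 0, 1) = (ε₂, 0, X) := by
  rw [hT]
  simp

/-- `(ε₁, X, 0) ∈ 𝔞L_ε` (hypothesis `h₁` of p456967 with `b = 1`). -/
theorem rel₁_mem_iSup
    (hT : ∀ (a d₁ d₂ : R) (x : R × R × R), T a d₁ d₂ x = (a * x.1 + ε₁ * d₁ * x.2.1 + ε₂ * d₂ * x.2.2,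
      (a + X * d₁) * x.2.1, (a + X * d₂) * x.2.2)) :
    (1 : R) • ((ε₁, X, 0) : R × R × R) ∈ ⨆ d : R × R, LinearMap.range (T 0 d.1 d.2) := by
  rw [one_smul]
  exact Submodule.mem_iSup_of_mem ((1, 0) : R × R)
    (LinearMap.mem_range.2 ⟨(0, 1, 0), apply_zero_one_zero_e₁ T hT⟩)

/-- `(ε₂, 0, X) ∈ 𝔞L_ε` (hypothesis `h₂` of p456967 with `b = 1`). -/
theorem rel₂_mem_iSup
    (hT : ∀ (a d₁ d₂ : R) (x : R × R × R), T a d₁ d₂ x = (a * x.1 + ε₁ * d₁ * x.2.1 + ε₂ * d₂ * x.2.2,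
      (a + X * d₁) * x.2.1, (a + X * d₂) * x.2.2)) :
    (1 : R) • ((ε₂, 0, X) : R × R × R) ∈ ⨆ d : R × R, LinearMap.range (T 0 d.1 d.2) := by
  rw [one_smul]
  exact Submodule.mem_iSup_of_mem ((0, 1) : R × R)
    (LinearMap.mem_range.2 ⟨(0, 0, 1), apply_zero_zero_one_e₂ T hT⟩)

/-- **The index bit for the Hecke relation module.** With `𝔞L_ε := ⨆ range (T 0 · ·)` — the module of
relations imposed by `ker λ_{𝐡_v}` — p456967's `span_h_eq_top_iff` applies verbatim (`b = 1`): the class of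
`h` generates the torsion-free quotient `F_ε` of `L_ε/𝔞L_ε` IFF `ε = (0,0)`. -/
theorem span_h_eq_top_iff [IsDomain R]
    (hT : ∀ (a d₁ d₂ : R) (x : R × R × R), T a d₁ d₂ x = (a * x.1 + ε₁ * d₁ * x.2.1 + ε₂ * d₂ * x.2.2,
      (a + X * d₁) * x.2.1, (a + X * d₂) * x.2.2))
    (hφ : ∀ x : R × R × R, φ x = X * x.1 - ε₁ * x.2.1 - ε₂ * x.2.2) (hX : X ≠ 0) (hXu : ¬ IsUnit X)
    (he₁ : ε₁ = 0 ∨ ε₁ = 1) (he₂ : ε₂ = 0 ∨ ε₂ = 1) :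
    Submodule.span R {(Submodule.Quotient.mk (Submodule.Quotient.mk ((1, 0, 0) : R × R × R)) :
        ((R × R × R) ⧸ (⨆ d : R × R, LinearMap.range (T 0 d.1 d.2))) ⧸
          Submodule.torsion R ((R × R × R) ⧸ (⨆ d : R × R, LinearMap.range (T 0 d.1 d.2))))} = ⊤ ↔
      (ε₁ = 0 ∧ ε₂ = 0) :=
  IndexTransfer.span_h_eq_top_iff φ hφ hX hXu _ (phi_eq_zero_of_mem_iSup T φ hT hφ) one_ne_zero
    (rel₁_mem_iSup T hT) (rel₂_mem_iSup T hT) he₁ he₂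

/-- **SPLIT BIT = INDEX BIT (bstw-MEMO-10 (C4), the three phrasings of TARGET l.2 (b) agree in the model).**
Over a domain, for `X ≠ 0` a non-unit and `ε_i ∈ {0,1}`, the following are equivalent: (1) `ε = (0,0)`;
(2) (♭′-1 fails) the Manin–Drinfeld-type extension `0 → Rh → L_ε → C → 0` splits `T`-equivariantly;
(3) (♭′-3 fails) every Hecke element acts on `L_ε/XL_ε` as a scalar; (4) (index bit) the class of `h`
generates the torsion-free quotient of `L_ε/𝔞L_ε`, i.e. BSTW I Prop. 3.11's display "image of `𝕋̂⁻_P` =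
`X·ℚ̄_p⟦X⟧`" FAILS. Hence (3-ii)♭′ ⟺ `ε ≠ (0,0)` in each of its three phrasings. -/
theorem splitBit_tfae [IsDomain R]
    (hT : ∀ (a d₁ d₂ : R) (x : R × R × R), T a d₁ d₂ x = (a * x.1 + ε₁ * d₁ * x.2.1 + ε₂ * d₂ * x.2.2,
      (a + X * d₁) * x.2.1, (a + X * d₂) * x.2.2))
    (Tb : R → R → R → ((R × R) →ₗ[R] (R × R)))
    (hTb : ∀ (a d₁ d₂ : R) (y : R × R), Tb a d₁ d₂ y = ((a + X * d₁) * y.1, (a + X * d₂) * y.2))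
    (hφ : ∀ x : R × R × R, φ x = X * x.1 - ε₁ * x.2.1 - ε₂ * x.2.2) (hX : X ≠ 0) (hXu : ¬ IsUnit X)
    (he₁ : ε₁ = 0 ∨ ε₁ = 1) (he₂ : ε₂ = 0 ∨ ε₂ = 1) :
    List.TFAE [ ε₁ = 0 ∧ ε₂ = 0,
      ∃ s : (R × R) →ₗ[R] (R × R × R), (LinearMap.snd R R (R × R)).comp s = LinearMap.id ∧
        ∀ a d₁ d₂ : R, (T a d₁ d₂).comp s = s.comp (Tb a d₁ d₂),
      ∀ (a d₁ d₂ : R) (x : R × R × R), T a d₁ d₂ x - a • x ∈ X • (⊤ : Submodule R (R × R × R)),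
      Submodule.span R {(Submodule.Quotient.mk (Submodule.Quotient.mk ((1, 0, 0) : R × R × R)) :
        ((R × R × R) ⧸ (⨆ d : R × R, LinearMap.range (T 0 d.1 d.2))) ⧸
          Submodule.torsion R ((R × R × R) ⧸ (⨆ d : R × R, LinearMap.range (T 0 d.1 d.2))))} = ⊤ ] := by
  tfae_have 2 ↔ 1 := exists_equivariant_section_iff T Tb hT hTb hXu he₁ he₂
  tfae_have 3 ↔ 1 := forall_sub_smul_mem_iff T hT hXu he₁ he₂
  tfae_have 4 ↔ 1 := span_h_eq_top_iff T φ hT hφ hX hXu he₁ he₂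
  tfae_finish

end Link

/-! ## (v) INVISIBILITY away from `X = 0` (bstw-MEMO-10 (R2)(i)/(R6)) -/

section Invisible

variable {X ε₁ ε₂ ε₁' ε₂' : R} (T T' : R → R → R → ((R × R × R) →ₗ[R] (R × R × R)))

/-- The shear `(x₀,x₁,x₂) ↦ (x₀ − c₁x₁ − c₂x₂, x₁, x₂)` is an `R`-linear automorphism of `R³`. -/
theorem exists_shear (c₁ c₂ : R) :
    ∃ Φ : (R × R × R) ≃ₗ[R] (R × R × R), ∀ x : R × R × R,
      Φ x = (x.1 - c₁ * x.2.1 - c₂ * x.2.2, x.2.1, x.2.2) := by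
  refine ⟨{ toFun := fun x => (x.1 - c₁ * x.2.1 - c₂ * x.2.2, x.2.1, x.2.2)
            map_add' := fun x y => by
              simp only [Prod.fst_add, Prod.snd_add, Prod.mk_add_mk, Prod.mk.injEq, and_true]
              ring
            map_smul' := fun r x => by
              simp only [Prod.smul_fst, Prod.smul_snd, smul_eq_mul, RingHom.id_apply, Prod.smul_mk,
                Prod.mk.injEq, and_true]
              ring
            invFun := fun x => (x.1 + c₁ * x.2.1 + c₂ * x.2.2, x.2.1, x.2.2)
            left_inv := fun x => by
              obtain ⟨x₀, x₁, x₂⟩ := x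
              simp only [Prod.mk.injEq, and_true]
              ring
            right_inv := fun x => by
              obtain ⟨x₀, x₁, x₂⟩ := x
              simp only [Prod.mk.injEq, and_true]
              ring }, fun x => rfl⟩

/-- **If `X` is a unit, all four lattices are isomorphic Hecke modules.** For ANY `ε, ε'` the shear with
`c_i = X⁻¹(ε_i − ε'_i)` intertwines `T^ε` and `T^ε'` — after inverting `X` (at every classical point
`P ≠ (X)` of the family) the bit disappears: "no classical specialisation sees it; no numerics can test
(3-ii)♭′" (bstw-MEMO-10 (R2)(i), (R6)). -/
theorem exists_equiv_of_isUnit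
    (hT : ∀ (a d₁ d₂ : R) (x : R × R × R), T a d₁ d₂ x = (a * x.1 + ε₁ * d₁ * x.2.1 + ε₂ * d₂ * x.2.2,
      (a + X * d₁) * x.2.1, (a + X * d₂) * x.2.2))
    (hT' : ∀ (a d₁ d₂ : R) (x : R × R × R), T' a d₁ d₂ x = (a * x.1 + ε₁' * d₁ * x.2.1 + ε₂' * d₂ * x.2.2,
      (a + X * d₁) * x.2.1, (a + X * d₂) * x.2.2))
    (hXunit : IsUnit X) :
    ∃ Φ : (R × R × R) ≃ₗ[R] (R × R × R), ∀ a d₁ d₂ : R,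
      (Φ : (R × R × R) →ₗ[R] (R × R × R)).comp (T a d₁ d₂) =
        (T' a d₁ d₂).comp (Φ : (R × R × R) →ₗ[R] (R × R × R)) := by
  obtain ⟨u, hu⟩ := hXunit.exists_left_inv
  obtain ⟨Φ, hΦ⟩ := exists_shear (R := R) (u * (ε₁ - ε₁')) (u * (ε₂ - ε₂'))
  refine ⟨Φ, fun a d₁ d₂ => ?_⟩
  apply LinearMap.ext
  intro x
  obtain ⟨x₀, x₁, x₂⟩ := x
  simp only [LinearMap.comp_apply, LinearEquiv.coe_coe, hΦ, hT, hT', Prod.mk.injEq, and_true]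
  linear_combination (-(ε₁ - ε₁') * d₁ * x₁ - (ε₂ - ε₂') * d₂ * x₂) * hu

end Invisible

/-! ## (vi) V6: for `X` a non-unit the four `L_ε` are pairwise non-isomorphic Hecke modules -/

section NonIso

variable {X ε₁ ε₂ ε₁' ε₂' : R} (T T' : R → R → R → ((R × R × R) →ₗ[R] (R × R × R)))

/-- If `T'_{(0,1,0)} m = 0` then `X m₁ = 0`, so `m₁ = 0` over a domain with `X ≠ 0`. -/
theorem snd_fst_eq_zero [IsDomain R]
    (hT' : ∀ (a d₁ d₂ : R) (x : R × R × R), T' a d₁ d₂ x = (a * x.1 + ε₁' * d₁ * x.2.1 + ε₂' * d₂ * x.2.2,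
      (a + X * d₁) * x.2.1, (a + X * d₂) * x.2.2))
    (hX : X ≠ 0) {m : R × R × R} (h : T' 0 1 0 m = 0) : m.2.1 = 0 := by
  rw [hT'] at h
  have h2 := congrArg (fun v : R × R × R => v.2.1) h
  simp only [Prod.snd_zero, Prod.fst_zero, zero_add, mul_one] at h2
  exact (mul_eq_zero.1 h2).resolve_left hX

/-- If `T'_{(0,0,1)} m = 0` then `m₂ = 0` over a domain with `X ≠ 0`. -/
theorem snd_snd_eq_zero [IsDomain R]
    (hT' : ∀ (a d₁ d₂ : R) (x : R × R × R), T' a d₁ d₂ x = (a * x.1 + ε₁' * d₁ * x.2.1 + ε₂' * d₂ * x.2.2,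
      (a + X * d₁) * x.2.1, (a + X * d₂) * x.2.2))
    (hX : X ≠ 0) {m : R × R × R} (h : T' 0 0 1 m = 0) : m.2.2 = 0 := by
  rw [hT'] at h
  have h2 := congrArg (fun v : R × R × R => v.2.2) h
  simp only [Prod.snd_zero, zero_add, mul_one] at h2
  exact (mul_eq_zero.1 h2).resolve_left hX

/-- **An intertwiner is triangular**: for an `R`-linear `Ψ` with `Ψ ∘ T_t = T'_t ∘ Ψ` for `t = (0,1,0)`
and `(0,0,1)`, over a domain with `X ≠ 0`: `Ψ h ∈ Rh`, `Ψ ẽ₁ ∈ Rh + Rẽ₁`, `Ψ ẽ₂ ∈ Rh + Rẽ₂`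
(an `𝓡`-map respects the three eigenlines). -/
theorem intertwiner_shape [IsDomain R]
    (hT : ∀ (a d₁ d₂ : R) (x : R × R × R), T a d₁ d₂ x = (a * x.1 + ε₁ * d₁ * x.2.1 + ε₂ * d₂ * x.2.2,
      (a + X * d₁) * x.2.1, (a + X * d₂) * x.2.2))
    (hT' : ∀ (a d₁ d₂ : R) (x : R × R × R), T' a d₁ d₂ x = (a * x.1 + ε₁' * d₁ * x.2.1 + ε₂' * d₂ * x.2.2,
      (a + X * d₁) * x.2.1, (a + X * d₂) * x.2.2))
    (hX : X ≠ 0) (Ψ : (R × R × R) →ₗ[R] (R × R × R))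
    (h₁ : Ψ.comp (T 0 1 0) = (T' 0 1 0).comp Ψ) (h₂ : Ψ.comp (T 0 0 1) = (T' 0 0 1).comp Ψ) :
    Ψ (1, 0, 0) = ((Ψ (1, 0, 0)).1, 0, 0) ∧ Ψ (0, 1, 0) = ((Ψ (0, 1, 0)).1, (Ψ (0, 1, 0)).2.1, 0) ∧
      Ψ (0, 0, 1) = ((Ψ (0, 0, 1)).1, 0, (Ψ (0, 0, 1)).2.2) := by
  have hTh₁ : T 0 1 0 (1, 0, 0) = 0 := by rw [hT]; simp
  have hTh₂ : T 0 0 1 (1, 0, 0) = 0 := by rw [hT]; simp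
  have hTe₁ : T 0 0 1 (0, 1, 0) = 0 := by rw [hT]; simp
  have hTe₂ : T 0 1 0 (0, 0, 1) = 0 := by rw [hT]; simp
  have k₁ : ∀ x, Ψ (T 0 1 0 x) = T' 0 1 0 (Ψ x) := fun x => by
    simpa using LinearMap.congr_fun h₁ x
  have k₂ : ∀ x, Ψ (T 0 0 1 x) = T' 0 0 1 (Ψ x) := fun x => by
    simpa using LinearMap.congr_fun h₂ x
  have a₁ : (Ψ (1, 0, 0)).2.1 = 0 :=
    snd_fst_eq_zero T' hT' hX (by rw [← k₁, hTh₁, map_zero])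
  have a₂ : (Ψ (1, 0, 0)).2.2 = 0 :=
    snd_snd_eq_zero T' hT' hX (by rw [← k₂, hTh₂, map_zero])
  have b₂ : (Ψ (0, 1, 0)).2.2 = 0 :=
    snd_snd_eq_zero T' hT' hX (by rw [← k₂, hTe₁, map_zero])
  have c₁ : (Ψ (0, 0, 1)).2.1 = 0 :=
    snd_fst_eq_zero T' hT' hX (by rw [← k₁, hTe₂, map_zero])
  refine ⟨?_, ?_, ?_⟩
  · exact Prod.ext rfl (Prod.ext a₁ a₂)
  · exact Prod.ext rfl (Prod.ext rfl b₂)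
  · exact Prod.ext rfl (Prod.ext c₁ rfl)

/-- **V6 (k3c2-MEMO-9 census), kernel form: the four `L_ε` are pairwise non-isomorphic Hecke modules.**
Over a domain, for `X ≠ 0` a non-unit and `ε_i, ε'_i ∈ {0,1}`: an `R`-linear ISOMORPHISM `Φ : L_ε → L_ε'`
intertwining the two families (`Φ ∘ T^ε_t = T^ε'_t ∘ Φ` for all `t`) forces `ε = ε'` (bstw-MEMO-10 §4:
"an `𝓡`-isomorphism is diagonal on `𝕎`; … `u₀h ∈ L₀` and `u₁e₁ − u₀h/X ∈ L₀` force `X ∣ u₀`"). Not used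
downstream (the finer bit pattern is invisible to Parts I–II); recorded to complete the dictionary. -/
theorem eps_eq_of_equiv [IsDomain R]
    (hT : ∀ (a d₁ d₂ : R) (x : R × R × R), T a d₁ d₂ x = (a * x.1 + ε₁ * d₁ * x.2.1 + ε₂ * d₂ * x.2.2,
      (a + X * d₁) * x.2.1, (a + X * d₂) * x.2.2))
    (hT' : ∀ (a d₁ d₂ : R) (x : R × R × R), T' a d₁ d₂ x = (a * x.1 + ε₁' * d₁ * x.2.1 + ε₂' * d₂ * x.2.2,
      (a + X * d₁) * x.2.1, (a + X * d₂) * x.2.2))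
    (hX : X ≠ 0) (hXu : ¬ IsUnit X) (he₁ : ε₁ = 0 ∨ ε₁ = 1) (he₂ : ε₂ = 0 ∨ ε₂ = 1)
    (he₁' : ε₁' = 0 ∨ ε₁' = 1) (he₂' : ε₂' = 0 ∨ ε₂' = 1) (Φ : (R × R × R) ≃ₗ[R] (R × R × R))
    (hΦ : ∀ a d₁ d₂ : R, (Φ : (R × R × R) →ₗ[R] (R × R × R)).comp (T a d₁ d₂) =
      (T' a d₁ d₂).comp (Φ : (R × R × R) →ₗ[R] (R × R × R))) :
    ε₁ = ε₁' ∧ ε₂ = ε₂' := by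
  -- the inverse intertwines the other way round
  have hΦ' : ∀ a d₁ d₂ : R, (Φ.symm : (R × R × R) →ₗ[R] (R × R × R)).comp (T' a d₁ d₂) =
      (T a d₁ d₂).comp (Φ.symm : (R × R × R) →ₗ[R] (R × R × R)) := by
    intro a d₁ d₂
    apply LinearMap.ext
    intro y
    have key := LinearMap.congr_fun (hΦ a d₁ d₂) (Φ.symm y)
    simp only [LinearMap.comp_apply, LinearEquiv.coe_coe, LinearEquiv.apply_symm_apply] at key
    simp only [LinearMap.comp_apply, LinearEquiv.coe_coe]
    rw [← key, LinearEquiv.symm_apply_apply]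
  -- triangular shapes of `Φ` and `Φ⁻¹` on the basis `(h, ẽ₁, ẽ₂)`
  obtain ⟨sh, se₁, se₂⟩ := intertwiner_shape T T' hT hT' hX
    (Φ : (R × R × R) →ₗ[R] (R × R × R)) (hΦ 0 1 0) (hΦ 0 0 1)
  obtain ⟨sh', se₁', se₂'⟩ := intertwiner_shape T' T hT' hT hX
    (Φ.symm : (R × R × R) →ₗ[R] (R × R × R)) (hΦ' 0 1 0) (hΦ' 0 0 1)
  simp only [LinearEquiv.coe_coe] at sh se₁ se₂ sh' se₁' se₂'
  obtain ⟨m₀, hm⟩ : ∃ m₀ : R, Φ (1, 0, 0) = (m₀, 0, 0) := ⟨_, sh⟩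
  obtain ⟨q₀, q₁, hq⟩ : ∃ q₀ q₁ : R, Φ (0, 1, 0) = (q₀, q₁, 0) := ⟨_, _, se₁⟩
  obtain ⟨r₀, r₂, hr⟩ : ∃ r₀ r₂ : R, Φ (0, 0, 1) = (r₀, 0, r₂) := ⟨_, _, se₂⟩
  obtain ⟨n₀, hn⟩ : ∃ n₀ : R, Φ.symm (1, 0, 0) = (n₀, 0, 0) := ⟨_, sh'⟩
  obtain ⟨p₀, p₁, hp⟩ : ∃ p₀ p₁ : R, Φ.symm (0, 1, 0) = (p₀, p₁, 0) := ⟨_, _, se₁'⟩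
  obtain ⟨o₀, o₂, ho⟩ : ∃ o₀ o₂ : R, Φ.symm (0, 0, 1) = (o₀, 0, o₂) := ⟨_, _, se₂'⟩
  -- the diagonal entries of `Φ` are units
  have U0 : n₀ * m₀ = 1 := by
    have e := Φ.apply_symm_apply ((1, 0, 0) : R × R × R)
    rw [hn, show ((n₀, 0, 0) : R × R × R) = n₀ • ((1, 0, 0) : R × R × R) by simp, map_smul,
      hm] at e
    simpa using congrArg Prod.fst e
  have U1 : p₁ * q₁ = 1 := by
    have e := Φ.apply_symm_apply ((0, 1, 0) : R × R × R)
    rw [hp, show ((p₀, p₁, 0) : R × R × R) = p₀ • ((1, 0, 0) : R × R × R) + p₁ • ((0, 1, 0) : R × R × R)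
      by simp, map_add, map_smul, map_smul, hm, hq] at e
    simpa using congrArg (fun v : R × R × R => v.2.1) e
  have U2 : o₂ * r₂ = 1 := by
    have e := Φ.apply_symm_apply ((0, 0, 1) : R × R × R)
    rw [ho, show ((o₀, 0, o₂) : R × R × R) = o₀ • ((1, 0, 0) : R × R × R) + o₂ • ((0, 0, 1) : R × R × R)
      by simp, map_add, map_smul, map_smul, hm, hr] at e
    simpa using congrArg (fun v : R × R × R => v.2.2) e
  -- the gluing relations read off `Φ ∘ T_t = T'_t ∘ Φ` on `ẽ₁`, `ẽ₂`
  have R1 : ε₁ * m₀ + X * q₀ = ε₁' * q₁ := by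
    have e := LinearMap.congr_fun (hΦ 0 1 0) ((0, 1, 0) : R × R × R)
    simp only [LinearMap.comp_apply, LinearEquiv.coe_coe, apply_zero_one_zero_e₁ T hT] at e
    rw [show ((ε₁, X, 0) : R × R × R) = ε₁ • ((1, 0, 0) : R × R × R) + X • ((0, 1, 0) : R × R × R)
      by simp, map_add, map_smul, map_smul, hm, hq, hT'] at e
    have e1 := congrArg Prod.fst e
    simp at e1
    linear_combination e1
  have R2 : ε₂ * m₀ + X * r₀ = ε₂' * r₂ := by
    have e := LinearMap.congr_fun (hΦ 0 0 1) ((0, 0, 1) : R × R × R)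
    simp only [LinearMap.comp_apply, LinearEquiv.coe_coe, apply_zero_zero_one_e₂ T hT] at e
    rw [show ((ε₂, 0, X) : R × R × R) = ε₂ • ((1, 0, 0) : R × R × R) + X • ((0, 0, 1) : R × R × R)
      by simp, map_add, map_smul, map_smul, hm, hr, hT'] at e
    have e1 := congrArg Prod.fst e
    simp at e1
    linear_combination e1
  constructor
  · rcases he₁ with h | h <;> rcases he₁' with h' | h'
    · rw [h, h']
    · exfalso
      rw [h, h'] at R1
      exact hXu (isUnit_iff_exists_inv.2 ⟨p₁ * q₀, by linear_combination p₁ * R1 + U1⟩)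
    · exfalso
      rw [h, h'] at R1
      exact hXu (isUnit_iff_exists_inv.2 ⟨-(n₀ * q₀), by linear_combination (-n₀) * R1 + U0⟩)
    · rw [h, h']
  · rcases he₂ with h | h <;> rcases he₂' with h' | h'
    · rw [h, h']
    · exfalso
      rw [h, h'] at R2
      exact hXu (isUnit_iff_exists_inv.2 ⟨o₂ * r₀, by linear_combination o₂ * R2 + U2⟩)
    · exfalso
      rw [h, h'] at R2
      exact hXu (isUnit_iff_exists_inv.2 ⟨-(n₀ * r₀), by linear_combination (-n₀) * R2 + U0⟩)
    · rw [h, h']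

end NonIso

end Summit.BirchSwinnertonDyer.BirchSwinnertonDyer.Theorems.SplitBit
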